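import Mathlib
import HarnessLib
import HarnessLib.Audit
import Summits.AtomisticToContinuum.Crystallization.Statement
import Summits.AtomisticToContinuum.Crystallization.Theses.OneCentreSteepnessLadder
import Literature.MathematicalPhysics.StatisticalMechanics.BarlowStacking
import Literature.MathematicalPhysics.StatisticalMechanics.HaggStacking
import Literature.Geometry.DiscreteGeometry.KissingPatterns

/-!
# Crux `LadderDomination` (stmt-AtomisticToContinuum-12884) — birth skeleton (BC3)

Route `OneCentreSteepnessLadder`, sub-problem `Crystallization`, crux rank 3 (THE LADDER ENGINE):

  `∃ q₀ ∀ q ≥ q₀ ∃ (a, h)` with `2a < 3h`, `6h < 5a` such that `∀ η ∃ γ ∀ ε ∀ R₀ ∃ R ≥ R₀ ∃ g`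
  (range-`R` rule, antisymmetric on every `(1 − 2/q)`-separated `S ⊂ ℝ³`) with
  `Φ^{≤R}_S(x) + T_g(x) ≤ Φ_hcp(q, a, h) + ε` at every centre, improved by `γ` wherever the closed
  `5a/3`-neighbourhood of `x` is not two-way `η`-matched to `hcpStacking a h`
  (`φ_q(r) = 2r^{-q} − r^{-2q}`, `Φ_hcp = ∑' p ∈ hcpStacking a h, φ_q ‖p‖`).

## The line (five named stubs = the four external inputs of the engine + the engine)

The crux-attack and route-review notes on the item (workitem archive 20442–20444) isolate exactly
four inputs that any proof of the engine consumes and that are theorems in their own right: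

* `stub_localTwelveRigidity` — LOCAL FEJES TÓTH AT `η = 0`: VERBATIM the signature of the route's
  crux #2 `OneCentreSteepnessLadder.LocalTwelveRigidity` (item stmt-AtomisticToContinuum-12883,
  the declared dep of this crux); discharged by name the day 12883 closes.
* `stub_kissingSlack` — FIRST SHELL `≤ 12` WITH SLACK: `∃ q₀ ∀ q ≥ q₀ ∃ τ > 0`, every point of a
  `(1 − 2/q)`-separated set has at most twelve other points within `1 + τ` (Tammes-13 /
  `k(3) = 12` + compactness; tree: `maxMinDist_thirteen_lt_one`, `musin2006_kissing_three_holds`).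
* `stub_hcpScaleSelection` — SCALE SELECTION: for `q ≥ q₀` the relaxed-hcp one-centre value
  `Φ_hcp(q, ·, ·)` has a COERCIVELY UNIQUE maximiser `(a, h)` inside the window, `a ∈ [9/10, 11/10]`
  (coercivity of the crux at foreign hcp scales silently needs uniqueness of the argmax).
* `stub_barlowSiteTable` — HCP IS THE POINTWISE MAXIMUM AMONG BARLOW SITES, STRICTLY OFF THE
  SILENT CLASS: for `q ≥ q₀` and every `(a, h)` in box × window there is `Δ > 0` with
  `V_q(s, z) ≤ Φ_hcp(q, a, h)` for every site `z = barlowPos a h s m i j` of every Barlow stacking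
  (`IsHaggSeq s`), and `V_q(s, z) + Δ ≤ Φ_hcp` whenever layer `m` is NOT aligned with layer `m + 2`
  or with layer `m − 2` (sites aligned at `±2` — hcp sites and the cuboctahedral "silent" twins of
  dhcp type — are EXACTLY hcp-radial to all orders inside `5a/3`, so no pointwise gap is claimed
  there: their gain is the engine's transfer business).
* `stub_dominationEngine` — THE ENGINE GIVEN ITS INPUTS, in UNIFORM-RADIUS form: for `q ≥ q₁` and
  `(a, h)` in the window carrying the coercive-argmax property, given a Barlow table with gap `Δ`,
  a kissing slack `τ` and local twelve-rigidity, `∀ η ∃ γ ∀ ε ∃ Rₑ ∃ g` (ONE rule of range `Rₑ`)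
  such that for EVERY truncation radius `R ≥ Rₑ` and every admissible `S`, `x`:
  `Φ^{≤R}_S(x) + T^{Rₑ}_g(x) ≤ Φ_hcp + ε`, and `≤ Φ_hcp + ε − γ` off `η`-matched centres.

Composition `LadderDomination_of` (kernel-checked, no `sorry`): thresholds `q₁ + q₂ + q₃ + q₄`;
scale selection supplies `(a, h)`; the table and the kissing slack are instantiated there; the
engine yields uniform-radius domination; RANGE NORMALISATION turns it into the crux matrix: given
`R₀` take `R := max R₀ Rₑ` and the rule `g'(v, U) := g(v, U ∩ B̄(0, Rₑ))`, which is range-`R`,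
antisymmetric at radius `R` and has the same transfer sums because
`(T ∩ B̄(0, R)) ∩ B̄(0, Rₑ) = T ∩ B̄(0, Rₑ)` (`inter_closedBall_max`, rewritten under the `tsum`
binder); `LadderDomination_of_stubs` states the crux BY NAME from the five stubs.

`sorry` occurs only inside the five `stub_*` theorems.

Disproof used: none on file (`ledger crux ls stmt-AtomisticToContinuum-12884`: no `Disproof.lean`,
2026-08-17). Negatives index (`ledger negatives --problem AtomisticToContinuum`): 15929
(gapped twelve-shell census at tolerance 1/50) and 4146 (effective local Hales at 1/100) are
fixed-tolerance classification statements; no stub here classifies shells at a fixed tolerance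
(`stub_kissingSlack` only COUNTS, with `∃ τ`; `stub_localTwelveRigidity` is the exact `η = 0`
statement 12883), and 3506 (one-grain gluing `∀ P`) is unrelated.
-/

namespace Summit.AtomisticToContinuum.Crystallization.Cruxes.LadderDomination.Birth

/-! ## Glue lemma (proved) -/

/-- Range normalisation of environments: cutting an `R`-environment (`R = max R₀ Rₑ`) down to
radius `Rₑ` gives the `Rₑ`-environment. [folklore] -/
theorem inter_closedBall_max (T : Set (EuclideanSpace ℝ (Fin 3))) (R₀ Rₑ : ℝ) :
    T ∩ Metric.closedBall (0 : EuclideanSpace ℝ (Fin 3)) (max R₀ Rₑ) ∩ Metric.closedBall (0 : EuclideanSpace ℝ (Fin 3)) Rₑ =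
      T ∩ Metric.closedBall (0 : EuclideanSpace ℝ (Fin 3)) Rₑ := by
  rw [Set.inter_assoc,
    Set.inter_eq_right.mpr (Metric.closedBall_subset_closedBall (le_max_right R₀ Rₑ))]

/-! ## Named readings of the four interfaces (for the line card; the stubs inline them) -/

/-- UNIFORM-RADIUS coercive one-centre domination at exponent `q` against `hcp(a, h)`: one rule `g`
of range `Rₑ`, antisymmetric at radius `Rₑ`, such that for EVERY truncation radius `R ≥ Rₑ` the
truncated one-centre sum plus the `Rₑ`-transfer is `≤ Φ_hcp + ε`, and `≤ Φ_hcp + ε − γ` off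
`η`-matched centres. [folklore] -/
def UniformDomination (q : ℕ) (a h : ℝ) : Prop :=
  (∀ η : ℝ, 0 < η → ∃ γ : ℝ, 0 < γ ∧ ∀ ε : ℝ, 0 < ε → ∃ Rₑ : ℝ, ∃ g : EuclideanSpace ℝ (Fin 3) → Set (EuclideanSpace ℝ (Fin 3)) → ℝ, (∀ (v : EuclideanSpace ℝ (Fin 3)) (U : Set (EuclideanSpace ℝ (Fin 3))), Rₑ < ‖v‖ → g v U = 0) ∧ ∀ R : ℝ, Rₑ ≤ R → ∀ S : Set (EuclideanSpace ℝ (Fin 3)), (∀ x ∈ S, ∀ y ∈ S, x ≠ y → (1 - 2 / (q : ℝ)) ≤ dist x y) → (∀ x ∈ S, ∀ y ∈ S, g (y - x) (((fun z : EuclideanSpace ℝ (Fin 3) => z - x) '' S) ∩ Metric.closedBall (0 : EuclideanSpace ℝ (Fin 3)) Rₑ) = - g (x - y) (((fun z : EuclideanSpace ℝ (Fin 3) => z - y) '' S) ∩ Metric.closedBall (0 : EuclideanSpace ℝ (Fin 3)) Rₑ)) ∧ ∀ x ∈ S, ((∑' y : ↥S, (if dist x (y : EuclideanSpace ℝ (Fin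 3)) ≤ R then (2 * (dist x (y : EuclideanSpace ℝ (Fin 3)))⁻¹ ^ q - (dist x (y : EuclideanSpace ℝ (Fin 3)))⁻¹ ^ (2 * q)) else 0)) + (∑' y : ↥S, g ((y : EuclideanSpace ℝ (Fin 3)) - x) (((fun z : EuclideanSpace ℝ (Fin 3) => z - x) '' S) ∩ Metric.closedBall (0 : EuclideanSpace ℝ (Fin 3)) Rₑ)) ≤ (∑' p : ↥(Literature.MathematicalPhysics.StatisticalMechanics.hcpStacking a h), (2 * (‖(p : EuclideanSpace ℝ (Fin 3))‖)⁻¹ ^ q - (‖(p : EuclideanSpace ℝ (Fin 3))‖)⁻¹ ^ (2 * q))) + ε) ∧ (¬ (∃ A : EuclideanSpace ℝ (Fin 3) →ₗᵢ[ℝ] EuclideanSpace ℝ (Fin 3), (∀ p ∈ Literature.MathematicalPhysics.StatisticalMechanics.hcpStacking a h, ‖p‖ ≤ 5 / 3 * a → ∃ y ∈ S, dist y (x + A p) ≤ η) ∧ (∀ y ∈ S, dist y x ≤ 5 / 3 * a → ∃ p ∈ Literature.MathematicalPhysics.StatisticalMechanics.hcpStacking a h, dist y (x + A p) ≤ η))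 → (∑' y : ↥S, (if dist x (y : EuclideanSpace ℝ (Fin 3)) ≤ R then (2 * (dist x (y : EuclideanSpace ℝ (Fin 3)))⁻¹ ^ q - (dist x (y : EuclideanSpace ℝ (Fin 3)))⁻¹ ^ (2 * q)) else 0)) + (∑' y : ↥S, g ((y : EuclideanSpace ℝ (Fin 3)) - x) (((fun z : EuclideanSpace ℝ (Fin 3) => z - x) '' S) ∩ Metric.closedBall (0 : EuclideanSpace ℝ (Fin 3)) Rₑ)) ≤ (∑' p : ↥(Literature.MathematicalPhysics.StatisticalMechanics.hcpStacking a h), (2 * (‖(p : EuclideanSpace ℝ (Fin 3))‖)⁻¹ ^ q - (‖(p : EuclideanSpace ℝ (Fin 3))‖)⁻¹ ^ (2 * q))) + ε - γ))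

/-- `(a, h)` is a COERCIVELY UNIQUE maximiser of the relaxed-hcp one-centre value
`Φ_hcp(q, ·, ·)` over all positive scales. [folklore] -/
def CoerciveHcpScale (q : ℕ) (a h : ℝ) : Prop :=
  (∀ θ : ℝ, 0 < θ → ∃ κ : ℝ, 0 < κ ∧ ∀ a' h' : ℝ, 0 < a' → 0 < h' → θ ≤ max |a' - a| |h' - h| → (∑' p : ↥(Literature.MathematicalPhysics.StatisticalMechanics.hcpStacking a' h'), (2 * (‖(p : EuclideanSpace ℝ (Fin 3))‖)⁻¹ ^ q - (‖(p : EuclideanSpace ℝ (Fin 3))‖)⁻¹ ^ (2 * q))) + κ ≤ (∑' p : ↥(Literature.MathematicalPhysics.StatisticalMechanics.hcpStacking a h), (2 * (‖(p : EuclideanSpace ℝ (Fin 3))‖)⁻¹ ^ q - (‖(p : EuclideanSpace ℝ (Fin 3))‖)⁻¹ ^ (2 * q))))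

/-- BARLOW SITE TABLE with gap `Δ` at `(q, a, h)`: every site of every Barlow stacking has
one-centre value `≤ Φ_hcp(q, a, h)`, and `≤ Φ_hcp − Δ` when its layer is not aligned with the
layer two above or the layer two below. [folklore] -/
def BarlowSiteTable (q : ℕ) (a h Δ : ℝ) : Prop :=
  (∀ s : ℤ → ℤ, Literature.MathematicalPhysics.StatisticalMechanics.IsHaggSeq s → ∀ m i j : ℤ, ((∑' p : ↥(Literature.MathematicalPhysics.StatisticalMechanics.barlowStacking a h s), (2 * (dist (Literature.MathematicalPhysics.StatisticalMechanics.barlowPos a h s m i j) (p : EuclideanSpace ℝ (Fin 3)))⁻¹ ^ q - (dist (Literature.MathematicalPhysics.StatisticalMechanics.barlowPos a h s m i j) (p : EuclideanSpace ℝ (Fin 3)))⁻¹ ^ (2 * q))) ≤ (∑' p : ↥(Literature.MathematicalPhysics.StatisticalMechanics.hcpStacking a h), (2 * (‖(p : EuclideanSpace ℝ (Fin 3))‖)⁻¹ ^ q - (‖(p : EuclideanSpace ℝ (Fin 3))‖)⁻¹ ^ (2 * q)))) ∧ ((¬ Literature.MathematicalPhysics.StatisticalMechanics.HaggAligned s m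 2 ∨ ¬ Literature.MathematicalPhysics.StatisticalMechanics.HaggAligned s (m - 2) 2) → (∑' p : ↥(Literature.MathematicalPhysics.StatisticalMechanics.barlowStacking a h s), (2 * (dist (Literature.MathematicalPhysics.StatisticalMechanics.barlowPos a h s m i j) (p : EuclideanSpace ℝ (Fin 3)))⁻¹ ^ q - (dist (Literature.MathematicalPhysics.StatisticalMechanics.barlowPos a h s m i j) (p : EuclideanSpace ℝ (Fin 3)))⁻¹ ^ (2 * q))) + Δ ≤ (∑' p : ↥(Literature.MathematicalPhysics.StatisticalMechanics.hcpStacking a h), (2 * (‖(p : EuclideanSpace ℝ (Fin 3))‖)⁻¹ ^ q - (‖(p : EuclideanSpace ℝ (Fin 3))‖)⁻¹ ^ (2 * q)))))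

/-- KISSING WITH SLACK `τ` at exponent `q`: a point of a `(1 − 2/q)`-separated set has at most
twelve other points within distance `1 + τ`. [folklore] -/
def KissingSlack (q : ℕ) (τ : ℝ) : Prop :=
  (∀ S : Set (EuclideanSpace ℝ (Fin 3)), (∀ x ∈ S, ∀ y ∈ S, x ≠ y → (1 - 2 / (q : ℝ)) ≤ dist x y) → ∀ x ∈ S, ({y : EuclideanSpace ℝ (Fin 3) | y ∈ S ∧ y ≠ x ∧ dist x y ≤ 1 + τ}).encard ≤ 12)

/-! ## The stubs -/

/-- **Stub 1 — LOCAL FEJES TÓTH AT `η = 0`** (VERBATIM the signature of item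
stmt-AtomisticToContinuum-12883, `OneCentreSteepnessLadder.LocalTwelveRigidity`, the declared dep
of the crux): pairwise distances `≥ 1`, `x` and every point within `1` of `x` twelve-kissed `⇒` the
unit shell of `x` is a linear-isometric image of the fcc or the hcp kissing pattern. Why plausibly
true: Hales 2012 (Flyspeck `L12` + contact-graph classification). Size XL (computer-assisted inputs
unproved in the tree). Used by the engine with compactness only (complete shells of admissible
configurations converge to exact twelve-kissed shells as `q → ∞`). -/
theorem stub_localTwelveRigidity : ∀ S : Set (EuclideanSpace ℝ (Fin 3)), (∀ x ∈ S, ∀ y ∈ S, x ≠ y → 1 ≤ dist x y) → ∀ x ∈ S, (∀ y ∈ S, dist x y ≤ 1 → 12 ≤ Set.ncard {z : EuclideanSpace ℝ (Fin 3) | z ∈ S ∧ dist y z = 1}) → ∃ A : EuclideanSpace ℝ (Fin 3) →ₗᵢ[ℝ] EuclideanSpace ℝ (Fin 3), {v : EuclideanSpace ℝ (Fin 3) | x + v ∈ S ∧ ‖v‖ = 1} = A '' (↑Literature.Geometry.DiscreteGeometry.fccKissingPattern : Set (EuclideanSpace ℝ (Fin 3))) ∨ {v : EuclideanSpace ℝ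 (Fin 3) | x + v ∈ S ∧ ‖v‖ = 1} = A '' (↑Literature.Geometry.DiscreteGeometry.hcpKissingPattern : Set (EuclideanSpace ℝ (Fin 3))) := by
  sorry

/-- **Stub 2 — FIRST SHELL `≤ 12` WITH SLACK.** `∃ q₀ ∀ q ≥ q₀ ∃ τ > 0`: in a `(1 − 2/q)`-separated
`S ⊂ ℝ³` every `x ∈ S` has at most twelve other points of `S` within `1 + τ` (`encard`, so the
statement also asserts finiteness). Why plausibly true: thirteen such points, rescaled by
`1/(1 − 2/q)` and radially projected, would be thirteen unit vectors at pairwise distance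
`≥ 1 − O(1/q + τ)`; `maxMinDist_thirteen_lt_one` (tree, proved from `musin2006_kissing_three_holds`)
plus compactness / the explicit bracket `maxMinDist 13 < 1` gives `q₀`, `τ`. Size M. The
route-review note puts the effective threshold near `q ≳ 46` before compactness margins. -/
theorem stub_kissingSlack : ∃ q₄ : ℕ, ∀ q : ℕ, q₄ ≤ q → ∃ τ : ℝ, 0 < τ ∧ (∀ S : Set (EuclideanSpace ℝ (Fin 3)), (∀ x ∈ S, ∀ y ∈ S, x ≠ y → (1 - 2 / (q : ℝ)) ≤ dist x y) → ∀ x ∈ S, ({y : EuclideanSpace ℝ (Fin 3) | y ∈ S ∧ y ≠ x ∧ dist x y ≤ 1 + τ}).encard ≤ 12) := by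
  sorry

/-- **Stub 3 — SCALE SELECTION (coercively unique argmax of the hcp one-centre value).**
`∃ q₀ ∀ q ≥ q₀ ∃ (a, h)`: `0 < a`, `0 < h`, `2a < 3h`, `6h < 5a`, `9/10 ≤ a ≤ 11/10`, and for every
`θ > 0` some `κ > 0` with `Φ_hcp(q, a', h') + κ ≤ Φ_hcp(q, a, h)` for all positive `(a', h')` at
sup-distance `≥ θ` from `(a, h)`. Why plausibly true: for large `q` the value is
`6φ_q(a) + 6φ_q(√(a²/3 + h²)) +` (terms `O(2^{-q/2})`), whose unique non-degenerate maximum sits at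
`a → 1⁻`, `h/a → √(2/3) ∈ (2/3, 5/6)` (refuter numerics: `a* = 0.99997`, `h*/a* = 0.816497` at
`q = 20`); coercivity follows from uniqueness, continuity of the lattice sums (`q ≥ 4`) and
`Φ_hcp → 0` resp. `−∞` at infinity resp. at degenerate scales. Size M–L. Fails iff the argmax
is degenerate or non-unique at infinitely many `q` (then the crux itself fails: two optimal hcp
scales are mutually unmatched with zero deficit). -/
theorem stub_hcpScaleSelection : ∃ q₂ : ℕ, ∀ q : ℕ, q₂ ≤ q → ∃ a h : ℝ, 0 < a ∧ 0 < h ∧ 2 * a < 3 * h ∧ 6 * h < 5 * a ∧ 9 / 10 ≤ a ∧ a ≤ 11 / 10 ∧ (∀ θ : ℝ, 0 < θ → ∃ κ : ℝ, 0 < κ ∧ ∀ a' h' : ℝ, 0 < a' → 0 < h' → θ ≤ max |a' - a| |h' - h| → (∑' p : ↥(Literature.MathematicalPhysics.StatisticalMechanics.hcpStacking a' h'), (2 * (‖(p : EuclideanSpace ℝ (Fin 3))‖)⁻¹ ^ q - (‖(p : EuclideanSpace ℝ (Fin 3))‖)⁻¹ ^ (2 * q))) + κ ≤ (∑' p : ↥(Literature.MathematicalPhysics.StatisticalMechanics.hcpStacking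 a h), (2 * (‖(p : EuclideanSpace ℝ (Fin 3))‖)⁻¹ ^ q - (‖(p : EuclideanSpace ℝ (Fin 3))‖)⁻¹ ^ (2 * q)))) := by
  sorry

/-- **Stub 4 — BARLOW SITE TABLE (hcp is the pointwise maximum among Barlow sites, strictly off
the silent class).** `∃ q₀ ∀ q ≥ q₀ ∀ a ∈ [9/10, 11/10] ∀ h` with `2a < 3h`, `6h < 5a`, `∃ Δ > 0`:
for every Hägg sequence `s` and site `z = barlowPos a h s m i j`,
`∑' p ∈ barlowStacking a h s, φ_q(dist z p) ≤ Φ_hcp(q, a, h)`, and `+ Δ ≤ Φ_hcp` if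
`¬ HaggAligned s m 2 ∨ ¬ HaggAligned s (m − 2) 2`. Why plausibly true: the value of a site depends
only on its alignment set `A = {k : layers m, m + k aligned}` (per direction), a set with
`1 ∉ A` and gaps `≥ 2`; with `J_k = Φ_A(k) − Φ_N(k)` (`barlowCoupling φ_q a h k`) one has
`V − Φ_hcp = Σ_dir (Σ_{k ∈ A} J_k − Σ_{k even} J_k) ≤ 0` as soon as `J_k ≥ 0` is non-increasing in
`k ≥ 2` (the `i`-th element of `A` is `≥ 2i`), with gap `J₂ − J₃` when `2 ∉ A`; leading order
`J₂ > 0 ⇔ (1 + a²/(12h²))^{q/2} > 3`, i.e. `q ≥ 19` at the ideal ratio (refuter check: `f_k > g_k`,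
`k = 2..6`, all `q ≥ 12`, cutoff `9a`). Size L: positivity AND monotonicity of `J_k` are needed for
ALL `k ≥ 2` (large-`k` regime: Poisson summation / positive-definiteness of
`y ↦ φ_q(√(k²h² + |y|²))` on the triangular lattice — not in Mathlib for `ℤ²`). Fails iff some
`J_k(q, a, h)` is negative or `k ↦ J_k` increases somewhere, uniformly obstructing `q₀`. -/
theorem stub_barlowSiteTable : ∃ q₃ : ℕ, ∀ q : ℕ, q₃ ≤ q → ∀ a h : ℝ, 9 / 10 ≤ a → a ≤ 11 / 10 → 0 < h → 2 * a < 3 * h → 6 * h < 5 * a → ∃ Δ : ℝ, 0 < Δ ∧ (∀ s : ℤ → ℤ, Literature.MathematicalPhysics.StatisticalMechanics.IsHaggSeq s → ∀ m i j : ℤ, ((∑' p : ↥(Literature.MathematicalPhysics.StatisticalMechanics.barlowStacking a h s), (2 * (dist (Literature.MathematicalPhysics.StatisticalMechanics.barlowPos a h s m i j) (p : EuclideanSpace ℝ (Fin 3)))⁻¹ ^ q - (dist (Literature.MathematicalPhysics.StatisticalMechanics.barlowPos a h s m i j) (p : EuclideanSpace ℝ (Fin 3)))⁻¹ ^ (2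 * q))) ≤ (∑' p : ↥(Literature.MathematicalPhysics.StatisticalMechanics.hcpStacking a h), (2 * (‖(p : EuclideanSpace ℝ (Fin 3))‖)⁻¹ ^ q - (‖(p : EuclideanSpace ℝ (Fin 3))‖)⁻¹ ^ (2 * q)))) ∧ ((¬ Literature.MathematicalPhysics.StatisticalMechanics.HaggAligned s m 2 ∨ ¬ Literature.MathematicalPhysics.StatisticalMechanics.HaggAligned s (m - 2) 2) → (∑' p : ↥(Literature.MathematicalPhysics.StatisticalMechanics.barlowStacking a h s), (2 * (dist (Literature.MathematicalPhysics.StatisticalMechanics.barlowPos a h s m i j) (p : EuclideanSpace ℝ (Fin 3)))⁻¹ ^ q - (dist (Literature.MathematicalPhysics.StatisticalMechanics.barlowPos a h s m i j) (p : EuclideanSpace ℝ (Fin 3)))⁻¹ ^ (2 * q))) + Δ ≤ (∑' p : ↥(Literature.MathematicalPhysics.StatisticalMechanics.hcpStacking a h), (2 * (‖(p : EuclideanSpace ℝ (Fin 3))‖)⁻¹ ^ q - (‖(p : EuclideanSpace ℝ (Fin 3))‖)⁻¹ ^ (2 * q))))) := by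
  sorry

/-- **Stub 5 — THE DOMINATION ENGINE GIVEN ITS INPUTS (uniform-radius form).** For `q ≥ q₁` and
`(a, h)` in the window with the coercive-argmax property (Stub 3), given ANY Barlow table with gap
`Δ > 0` at `(q, a, h)` (Stub 4), ANY kissing slack `τ > 0` at `q` (Stub 2) and local
twelve-rigidity (Stub 1, by name), produce `∀ η ∃ γ ∀ ε ∃ Rₑ ∃ g`: a rule of range `Rₑ`,
antisymmetric at radius `Rₑ` on every `(1 − 2/q)`-separated `S`, with
`Φ^{≤R}_S(x) + T^{Rₑ}_g(x) ≤ Φ_hcp(q, a, h) + ε` for EVERY `R ≥ Rₑ` and every `x ∈ S`, and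
`≤ Φ_hcp + ε − γ` when the closed `5a/3`-neighbourhood of `x` is not two-way `η`-matched to
`hcpStacking a h`. This is where the one-centre discharging lives: first shell `≤ 12` (kissing
slack) and `O(1)` deficit of under-kissed atoms; complete non-fcc/hcp shells have an under-kissed
point within `1` (twelve-rigidity + compactness) whose deficit pays, through `g` (range `2`,
boundedly many claimants), every second-shell surplus (deep holes `≥ 1.26`, bare surplus only for
`q ≳ 145`); Barlow-matched centres are read off the table (gap `Δ` off the silent class, the silent
cuboctahedral twins are paid by their flanking layers' `Δ` through `g`); foreign hcp scales are
paid by the coercive argmax; near the equality case the strain-linear transfer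
`t(x, y) = −φ′(r) ê·(u_x + u_y)` cancels first-order terms and the localised phonon form is
negative. Why it might fail: a surplus whose compensating deficit lies beyond every fixed range;
the near-field second-order form; the silent-site cap `γ(η) ≲ (2/3)(f₂ − g₂)`. Size XL (the
crux's own difficulty minus the four inputs). -/
theorem stub_dominationEngine : ∃ q₁ : ℕ, ∀ q : ℕ, q₁ ≤ q → ∀ a h : ℝ, 0 < a → 0 < h → 2 * a < 3 * h → 6 * h < 5 * a → (∀ θ : ℝ, 0 < θ → ∃ κ : ℝ, 0 < κ ∧ ∀ a' h' : ℝ, 0 < a' → 0 < h' → θ ≤ max |a' - a| |h' - h| → (∑' p : ↥(Literature.MathematicalPhysics.StatisticalMechanics.hcpStacking a' h'), (2 * (‖(p : EuclideanSpace ℝ (Fin 3))‖)⁻¹ ^ q - (‖(p : EuclideanSpace ℝ (Fin 3))‖)⁻¹ ^ (2 * q))) + κ ≤ (∑' p : ↥(Literature.MathematicalPhysics.StatisticalMechanics.hcpStacking a h), (2 * (‖(p : EuclideanSpace ℝ (Fin 3))‖)⁻¹ ^ q - (‖(p : EuclideanSpace ℝ (Fin 3))‖)⁻¹ ^ (2 *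 q)))) → ∀ Δ : ℝ, 0 < Δ → (∀ s : ℤ → ℤ, Literature.MathematicalPhysics.StatisticalMechanics.IsHaggSeq s → ∀ m i j : ℤ, ((∑' p : ↥(Literature.MathematicalPhysics.StatisticalMechanics.barlowStacking a h s), (2 * (dist (Literature.MathematicalPhysics.StatisticalMechanics.barlowPos a h s m i j) (p : EuclideanSpace ℝ (Fin 3)))⁻¹ ^ q - (dist (Literature.MathematicalPhysics.StatisticalMechanics.barlowPos a h s m i j) (p : EuclideanSpace ℝ (Fin 3)))⁻¹ ^ (2 * q))) ≤ (∑' p : ↥(Literature.MathematicalPhysics.StatisticalMechanics.hcpStacking a h), (2 * (‖(p : EuclideanSpace ℝ (Fin 3))‖)⁻¹ ^ q - (‖(p : EuclideanSpace ℝ (Fin 3))‖)⁻¹ ^ (2 * q)))) ∧ ((¬ Literature.MathematicalPhysics.StatisticalMechanics.HaggAligned s m 2 ∨ ¬ Literature.MathematicalPhysics.StatisticalMechanics.HaggAligned s (m - 2) 2) → (∑' p : ↥(Literature.MathematicalPhysics.StatisticalMechanics.barlowStacking a h s), (2 * (dist (Literature.MathematicalPhysics.StatisticalMechanics.barlowPos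 a h s m i j) (p : EuclideanSpace ℝ (Fin 3)))⁻¹ ^ q - (dist (Literature.MathematicalPhysics.StatisticalMechanics.barlowPos a h s m i j) (p : EuclideanSpace ℝ (Fin 3)))⁻¹ ^ (2 * q))) + Δ ≤ (∑' p : ↥(Literature.MathematicalPhysics.StatisticalMechanics.hcpStacking a h), (2 * (‖(p : EuclideanSpace ℝ (Fin 3))‖)⁻¹ ^ q - (‖(p : EuclideanSpace ℝ (Fin 3))‖)⁻¹ ^ (2 * q))))) → ∀ τ : ℝ, 0 < τ → (∀ S : Set (EuclideanSpace ℝ (Fin 3)), (∀ x ∈ S, ∀ y ∈ S, x ≠ y → (1 - 2 / (q : ℝ)) ≤ dist x y) → ∀ x ∈ S, ({y : EuclideanSpace ℝ (Fin 3) | y ∈ S ∧ y ≠ x ∧ dist x y ≤ 1 + τ}).encard ≤ 12) → Summit.AtomisticToContinuum.Crystallization.Theses.OneCentreSteepnessLadder.LocalTwelveRigidity → (∀ η : ℝ, 0 < η → ∃ γ : ℝ, 0 < γ ∧ ∀ ε : ℝ, 0 < ε → ∃ Rₑ : ℝ, ∃ g : EuclideanSpace ℝ (Fin 3) → Set (EuclideanSpace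 ℝ (Fin 3)) → ℝ, (∀ (v : EuclideanSpace ℝ (Fin 3)) (U : Set (EuclideanSpace ℝ (Fin 3))), Rₑ < ‖v‖ → g v U = 0) ∧ ∀ R : ℝ, Rₑ ≤ R → ∀ S : Set (EuclideanSpace ℝ (Fin 3)), (∀ x ∈ S, ∀ y ∈ S, x ≠ y → (1 - 2 / (q : ℝ)) ≤ dist x y) → (∀ x ∈ S, ∀ y ∈ S, g (y - x) (((fun z : EuclideanSpace ℝ (Fin 3) => z - x) '' S) ∩ Metric.closedBall (0 : EuclideanSpace ℝ (Fin 3)) Rₑ) = - g (x - y) (((fun z : EuclideanSpace ℝ (Fin 3) => z - y) '' S) ∩ Metric.closedBall (0 : EuclideanSpace ℝ (Fin 3)) Rₑ)) ∧ ∀ x ∈ S, ((∑' y : ↥S, (if dist x (y : EuclideanSpace ℝ (Fin 3)) ≤ R then (2 * (dist x (y : EuclideanSpace ℝ (Fin 3)))⁻¹ ^ q - (dist x (y : EuclideanSpace ℝ (Fin 3)))⁻¹ ^ (2 * q)) else 0)) + (∑' y : ↥S, g ((y : EuclideanSpace ℝ (Fin 3)) - x) (((fun z : EuclideanSpace ℝ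 (Fin 3) => z - x) '' S) ∩ Metric.closedBall (0 : EuclideanSpace ℝ (Fin 3)) Rₑ)) ≤ (∑' p : ↥(Literature.MathematicalPhysics.StatisticalMechanics.hcpStacking a h), (2 * (‖(p : EuclideanSpace ℝ (Fin 3))‖)⁻¹ ^ q - (‖(p : EuclideanSpace ℝ (Fin 3))‖)⁻¹ ^ (2 * q))) + ε) ∧ (¬ (∃ A : EuclideanSpace ℝ (Fin 3) →ₗᵢ[ℝ] EuclideanSpace ℝ (Fin 3), (∀ p ∈ Literature.MathematicalPhysics.StatisticalMechanics.hcpStacking a h, ‖p‖ ≤ 5 / 3 * a → ∃ y ∈ S, dist y (x + A p) ≤ η) ∧ (∀ y ∈ S, dist y x ≤ 5 / 3 * a → ∃ p ∈ Literature.MathematicalPhysics.StatisticalMechanics.hcpStacking a h, dist y (x + A p) ≤ η)) → (∑' y : ↥S, (if dist x (y : EuclideanSpace ℝ (Fin 3)) ≤ R then (2 * (dist x (y : EuclideanSpace ℝ (Fin 3)))⁻¹ ^ q - (dist x (y : EuclideanSpace ℝ (Fin 3)))⁻¹ ^ (2 * q)) else 0)) + (∑' y : ↥S, g ((y : EuclideanSpace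 ℝ (Fin 3)) - x) (((fun z : EuclideanSpace ℝ (Fin 3) => z - x) '' S) ∩ Metric.closedBall (0 : EuclideanSpace ℝ (Fin 3)) Rₑ)) ≤ (∑' p : ↥(Literature.MathematicalPhysics.StatisticalMechanics.hcpStacking a h), (2 * (‖(p : EuclideanSpace ℝ (Fin 3))‖)⁻¹ ^ q - (‖(p : EuclideanSpace ℝ (Fin 3))‖)⁻¹ ^ (2 * q))) + ε - γ)) := by
  sorry

/-! ## The composition (kernel-checked, no sorry) -/

/-- **Range normalisation**: uniform-radius domination at `(q, a, h)` implies the crux matrix at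
`(q, a, h)` — given `R₀`, use `R := max R₀ Rₑ` and the rule `g'(v, U) := g(v, U ∩ B̄(0, Rₑ))`.
[folklore] -/
theorem cruxMatrix_of_uniform (q : ℕ) (a h : ℝ) :
    (∀ η : ℝ, 0 < η → ∃ γ : ℝ, 0 < γ ∧ ∀ ε : ℝ, 0 < ε → ∃ Rₑ : ℝ, ∃ g : EuclideanSpace ℝ (Fin 3) → Set (EuclideanSpace ℝ (Fin 3)) → ℝ, (∀ (v : EuclideanSpace ℝ (Fin 3)) (U : Set (EuclideanSpace ℝ (Fin 3))), Rₑ < ‖v‖ → g v U = 0) ∧ ∀ R : ℝ, Rₑ ≤ R → ∀ S : Set (EuclideanSpace ℝ (Fin 3)), (∀ x ∈ S, ∀ y ∈ S, x ≠ y → (1 - 2 / (q : ℝ)) ≤ dist x y) → (∀ x ∈ S, ∀ y ∈ S, g (y - x) (((fun z : EuclideanSpace ℝ (Fin 3) => z - x) '' S) ∩ Metric.closedBall (0 : EuclideanSpace ℝ (Fin 3)) Rₑ) = - g (x - y) (((fun z : EuclideanSpace ℝ (Fin 3) => z - y) '' S) ∩ Metric.closedBall (0 : EuclideanSpace ℝ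 (Fin 3)) Rₑ)) ∧ ∀ x ∈ S, ((∑' y : ↥S, (if dist x (y : EuclideanSpace ℝ (Fin 3)) ≤ R then (2 * (dist x (y : EuclideanSpace ℝ (Fin 3)))⁻¹ ^ q - (dist x (y : EuclideanSpace ℝ (Fin 3)))⁻¹ ^ (2 * q)) else 0)) + (∑' y : ↥S, g ((y : EuclideanSpace ℝ (Fin 3)) - x) (((fun z : EuclideanSpace ℝ (Fin 3) => z - x) '' S) ∩ Metric.closedBall (0 : EuclideanSpace ℝ (Fin 3)) Rₑ)) ≤ (∑' p : ↥(Literature.MathematicalPhysics.StatisticalMechanics.hcpStacking a h), (2 * (‖(p : EuclideanSpace ℝ (Fin 3))‖)⁻¹ ^ q - (‖(p : EuclideanSpace ℝ (Fin 3))‖)⁻¹ ^ (2 * q))) + ε) ∧ (¬ (∃ A : EuclideanSpace ℝ (Fin 3) →ₗᵢ[ℝ] EuclideanSpace ℝ (Fin 3), (∀ p ∈ Literature.MathematicalPhysics.StatisticalMechanics.hcpStacking a h, ‖p‖ ≤ 5 / 3 * a → ∃ y ∈ S, dist y (x + A p) ≤ η) ∧ (∀ y ∈ S, dist y x ≤ 5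 / 3 * a → ∃ p ∈ Literature.MathematicalPhysics.StatisticalMechanics.hcpStacking a h, dist y (x + A p) ≤ η)) → (∑' y : ↥S, (if dist x (y : EuclideanSpace ℝ (Fin 3)) ≤ R then (2 * (dist x (y : EuclideanSpace ℝ (Fin 3)))⁻¹ ^ q - (dist x (y : EuclideanSpace ℝ (Fin 3)))⁻¹ ^ (2 * q)) else 0)) + (∑' y : ↥S, g ((y : EuclideanSpace ℝ (Fin 3)) - x) (((fun z : EuclideanSpace ℝ (Fin 3) => z - x) '' S) ∩ Metric.closedBall (0 : EuclideanSpace ℝ (Fin 3)) Rₑ)) ≤ (∑' p : ↥(Literature.MathematicalPhysics.StatisticalMechanics.hcpStacking a h), (2 * (‖(p : EuclideanSpace ℝ (Fin 3))‖)⁻¹ ^ q - (‖(p : EuclideanSpace ℝ (Fin 3))‖)⁻¹ ^ (2 * q))) + ε - γ)) →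
    (∀ η : ℝ, 0 < η → ∃ γ : ℝ, 0 < γ ∧ ∀ ε : ℝ, 0 < ε → ∀ R₀ : ℝ, ∃ R : ℝ, R₀ ≤ R ∧ ∃ g : EuclideanSpace ℝ (Fin 3) → Set (EuclideanSpace ℝ (Fin 3)) → ℝ, (∀ (v : EuclideanSpace ℝ (Fin 3)) (U : Set (EuclideanSpace ℝ (Fin 3))), R < ‖v‖ → g v U = 0) ∧ ∀ S : Set (EuclideanSpace ℝ (Fin 3)), (∀ x ∈ S, ∀ y ∈ S, x ≠ y → (1 - 2 / (q : ℝ)) ≤ dist x y) → (∀ x ∈ S, ∀ y ∈ S, g (y - x) (((fun z : EuclideanSpace ℝ (Fin 3) => z - x) '' S) ∩ Metric.closedBall (0 : EuclideanSpace ℝ (Fin 3)) R) = - g (x - y) (((fun z : EuclideanSpace ℝ (Fin 3) => z - y) '' S) ∩ Metric.closedBall (0 : EuclideanSpace ℝ (Fin 3)) R)) ∧ ∀ x ∈ S, ((∑' y : ↥S, (if dist x (y : EuclideanSpace ℝ (Fin 3)) ≤ R then (2 * (dist x (y : EuclideanSpace ℝ (Fin 3)))⁻¹ ^ q - (dist x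 (y : EuclideanSpace ℝ (Fin 3)))⁻¹ ^ (2 * q)) else 0)) + (∑' y : ↥S, g ((y : EuclideanSpace ℝ (Fin 3)) - x) (((fun z : EuclideanSpace ℝ (Fin 3) => z - x) '' S) ∩ Metric.closedBall (0 : EuclideanSpace ℝ (Fin 3)) R)) ≤ (∑' p : ↥(Literature.MathematicalPhysics.StatisticalMechanics.hcpStacking a h), (2 * (‖(p : EuclideanSpace ℝ (Fin 3))‖)⁻¹ ^ q - (‖(p : EuclideanSpace ℝ (Fin 3))‖)⁻¹ ^ (2 * q))) + ε) ∧ (¬ (∃ A : EuclideanSpace ℝ (Fin 3) →ₗᵢ[ℝ] EuclideanSpace ℝ (Fin 3), (∀ p ∈ Literature.MathematicalPhysics.StatisticalMechanics.hcpStacking a h, ‖p‖ ≤ 5 / 3 * a → ∃ y ∈ S, dist y (x + A p) ≤ η) ∧ (∀ y ∈ S, dist y x ≤ 5 / 3 * a → ∃ p ∈ Literature.MathematicalPhysics.StatisticalMechanics.hcpStacking a h, dist y (x + A p) ≤ η)) → (∑' y : ↥S, (if dist x (y : EuclideanSpace ℝ (Fin 3)) ≤ R then (2 * (dist x (y : EuclideanSpace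 ℝ (Fin 3)))⁻¹ ^ q - (dist x (y : EuclideanSpace ℝ (Fin 3)))⁻¹ ^ (2 * q)) else 0)) + (∑' y : ↥S, g ((y : EuclideanSpace ℝ (Fin 3)) - x) (((fun z : EuclideanSpace ℝ (Fin 3) => z - x) '' S) ∩ Metric.closedBall (0 : EuclideanSpace ℝ (Fin 3)) R)) ≤ (∑' p : ↥(Literature.MathematicalPhysics.StatisticalMechanics.hcpStacking a h), (2 * (‖(p : EuclideanSpace ℝ (Fin 3))‖)⁻¹ ^ q - (‖(p : EuclideanSpace ℝ (Fin 3))‖)⁻¹ ^ (2 * q))) + ε - γ)) := by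
  intro hU η hη
  obtain ⟨γ, hγ, hU⟩ := hU η hη
  refine ⟨γ, hγ, fun ε hε R₀ => ?_⟩
  obtain ⟨Rₑ, g, hloc, hU⟩ := hU ε hε
  refine ⟨max R₀ Rₑ, le_max_left _ _,
    fun v U => g v (U ∩ Metric.closedBall (0 : EuclideanSpace ℝ (Fin 3)) Rₑ), ?_, ?_⟩
  · intro v U hv
    exact hloc v _ (lt_of_le_of_lt (le_max_right R₀ Rₑ) hv)
  · intro S hS
    obtain ⟨hanti, hbound⟩ := hU (max R₀ Rₑ) (le_max_right R₀ Rₑ) S hS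
    refine ⟨fun x hx y hy => ?_, fun x hx => ?_⟩
    · simpa only [inter_closedBall_max] using hanti x hx y hy
    · simpa only [inter_closedBall_max] using hbound x hx

/-- **Composition** `stub₁ → stub₂ → stub₃ → stub₄ → stub₅ → LadderDomination` (the crux BY NAME;
real proof): thresholds `q₁ + q₂ + q₃ + q₄`; scale selection gives `(a, h)`; the Barlow table and
the kissing slack are instantiated at `(q, a, h)` resp. `q`; the engine gives uniform-radius
domination; `cruxMatrix_of_uniform` normalises the range. [folklore] -/
theorem LadderDomination_of :
    (∀ S : Set (EuclideanSpace ℝ (Fin 3)), (∀ x ∈ S, ∀ y ∈ S, x ≠ y → 1 ≤ dist x y) → ∀ x ∈ S, (∀ y ∈ S, dist x y ≤ 1 → 12 ≤ Set.ncard {z : EuclideanSpace ℝ (Fin 3) | z ∈ S ∧ dist y z = 1}) → ∃ A : EuclideanSpace ℝ (Fin 3) →ₗᵢ[ℝ] EuclideanSpace ℝ (Fin 3), {v : EuclideanSpace ℝ (Fin 3) | x + v ∈ S ∧ ‖v‖ = 1} = A '' (↑Literature.Geometry.DiscreteGeometry.fccKissingPattern : Set (EuclideanSpace ℝ (Fin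 3))) ∨ {v : EuclideanSpace ℝ (Fin 3) | x + v ∈ S ∧ ‖v‖ = 1} = A '' (↑Literature.Geometry.DiscreteGeometry.hcpKissingPattern : Set (EuclideanSpace ℝ (Fin 3)))) →
    (∃ q₄ : ℕ, ∀ q : ℕ, q₄ ≤ q → ∃ τ : ℝ, 0 < τ ∧ (∀ S : Set (EuclideanSpace ℝ (Fin 3)), (∀ x ∈ S, ∀ y ∈ S, x ≠ y → (1 - 2 / (q : ℝ)) ≤ dist x y) → ∀ x ∈ S, ({y : EuclideanSpace ℝ (Fin 3) | y ∈ S ∧ y ≠ x ∧ dist x y ≤ 1 + τ}).encard ≤ 12)) →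
    (∃ q₂ : ℕ, ∀ q : ℕ, q₂ ≤ q → ∃ a h : ℝ, 0 < a ∧ 0 < h ∧ 2 * a < 3 * h ∧ 6 * h < 5 * a ∧ 9 / 10 ≤ a ∧ a ≤ 11 / 10 ∧ (∀ θ : ℝ, 0 < θ → ∃ κ : ℝ, 0 < κ ∧ ∀ a' h' : ℝ, 0 < a' → 0 < h' → θ ≤ max |a' - a| |h' - h| → (∑' p : ↥(Literature.MathematicalPhysics.StatisticalMechanics.hcpStacking a' h'), (2 * (‖(p : EuclideanSpace ℝ (Fin 3))‖)⁻¹ ^ q - (‖(p : EuclideanSpace ℝ (Fin 3))‖)⁻¹ ^ (2 * q))) + κ ≤ (∑' p : ↥(Literature.MathematicalPhysics.StatisticalMechanics.hcpStacking a h), (2 * (‖(p : EuclideanSpace ℝ (Fin 3))‖)⁻¹ ^ q - (‖(p : EuclideanSpace ℝ (Fin 3))‖)⁻¹ ^ (2 * q))))) →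
    (∃ q₃ : ℕ, ∀ q : ℕ, q₃ ≤ q → ∀ a h : ℝ, 9 / 10 ≤ a → a ≤ 11 / 10 → 0 < h → 2 * a < 3 * h → 6 * h < 5 * a → ∃ Δ : ℝ, 0 < Δ ∧ (∀ s : ℤ → ℤ, Literature.MathematicalPhysics.StatisticalMechanics.IsHaggSeq s → ∀ m i j : ℤ, ((∑' p : ↥(Literature.MathematicalPhysics.StatisticalMechanics.barlowStacking a h s), (2 * (dist (Literature.MathematicalPhysics.StatisticalMechanics.barlowPos a h s m i j) (p : EuclideanSpace ℝ (Fin 3)))⁻¹ ^ q - (dist (Literature.MathematicalPhysics.StatisticalMechanics.barlowPos a h s m i j) (p : EuclideanSpace ℝ (Fin 3)))⁻¹ ^ (2 * q))) ≤ (∑' p : ↥(Literature.MathematicalPhysics.StatisticalMechanics.hcpStacking a h), (2 * (‖(p : EuclideanSpace ℝ (Fin 3))‖)⁻¹ ^ q - (‖(p : EuclideanSpace ℝ (Fin 3))‖)⁻¹ ^ (2 * q)))) ∧ ((¬ Literature.MathematicalPhysics.StatisticalMechanics.HaggAligned s m 2 ∨ ¬ Literature.MathematicalPhysics.StatisticalMechanics.HaggAligned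 s (m - 2) 2) → (∑' p : ↥(Literature.MathematicalPhysics.StatisticalMechanics.barlowStacking a h s), (2 * (dist (Literature.MathematicalPhysics.StatisticalMechanics.barlowPos a h s m i j) (p : EuclideanSpace ℝ (Fin 3)))⁻¹ ^ q - (dist (Literature.MathematicalPhysics.StatisticalMechanics.barlowPos a h s m i j) (p : EuclideanSpace ℝ (Fin 3)))⁻¹ ^ (2 * q))) + Δ ≤ (∑' p : ↥(Literature.MathematicalPhysics.StatisticalMechanics.hcpStacking a h), (2 * (‖(p : EuclideanSpace ℝ (Fin 3))‖)⁻¹ ^ q - (‖(p : EuclideanSpace ℝ (Fin 3))‖)⁻¹ ^ (2 * q)))))) →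
    (∃ q₁ : ℕ, ∀ q : ℕ, q₁ ≤ q → ∀ a h : ℝ, 0 < a → 0 < h → 2 * a < 3 * h → 6 * h < 5 * a → (∀ θ : ℝ, 0 < θ → ∃ κ : ℝ, 0 < κ ∧ ∀ a' h' : ℝ, 0 < a' → 0 < h' → θ ≤ max |a' - a| |h' - h| → (∑' p : ↥(Literature.MathematicalPhysics.StatisticalMechanics.hcpStacking a' h'), (2 * (‖(p : EuclideanSpace ℝ (Fin 3))‖)⁻¹ ^ q - (‖(p : EuclideanSpace ℝ (Fin 3))‖)⁻¹ ^ (2 * q))) + κ ≤ (∑' p : ↥(Literature.MathematicalPhysics.StatisticalMechanics.hcpStacking a h), (2 * (‖(p : EuclideanSpace ℝ (Fin 3))‖)⁻¹ ^ q - (‖(p : EuclideanSpace ℝ (Fin 3))‖)⁻¹ ^ (2 * q)))) → ∀ Δ : ℝ, 0 < Δ → (∀ s : ℤ → ℤ, Literature.MathematicalPhysics.StatisticalMechanics.IsHaggSeq s → ∀ m i j : ℤ, ((∑' p : ↥(Literature.MathematicalPhysics.StatisticalMechanics.barlowStacking a h s), (2 * (dist (Literature.MathematicalPhysics.StatisticalMechanics.barlowPos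 a h s m i j) (p : EuclideanSpace ℝ (Fin 3)))⁻¹ ^ q - (dist (Literature.MathematicalPhysics.StatisticalMechanics.barlowPos a h s m i j) (p : EuclideanSpace ℝ (Fin 3)))⁻¹ ^ (2 * q))) ≤ (∑' p : ↥(Literature.MathematicalPhysics.StatisticalMechanics.hcpStacking a h), (2 * (‖(p : EuclideanSpace ℝ (Fin 3))‖)⁻¹ ^ q - (‖(p : EuclideanSpace ℝ (Fin 3))‖)⁻¹ ^ (2 * q)))) ∧ ((¬ Literature.MathematicalPhysics.StatisticalMechanics.HaggAligned s m 2 ∨ ¬ Literature.MathematicalPhysics.StatisticalMechanics.HaggAligned s (m - 2) 2) → (∑' p : ↥(Literature.MathematicalPhysics.StatisticalMechanics.barlowStacking a h s), (2 * (dist (Literature.MathematicalPhysics.StatisticalMechanics.barlowPos a h s m i j) (p : EuclideanSpace ℝ (Fin 3)))⁻¹ ^ q - (dist (Literature.MathematicalPhysics.StatisticalMechanics.barlowPos a h s m i j) (p : EuclideanSpace ℝ (Fin 3)))⁻¹ ^ (2 * q))) + Δ ≤ (∑' p : ↥(Literature.MathematicalPhysics.StatisticalMechanics.hcpStacking a h),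 (2 * (‖(p : EuclideanSpace ℝ (Fin 3))‖)⁻¹ ^ q - (‖(p : EuclideanSpace ℝ (Fin 3))‖)⁻¹ ^ (2 * q))))) → ∀ τ : ℝ, 0 < τ → (∀ S : Set (EuclideanSpace ℝ (Fin 3)), (∀ x ∈ S, ∀ y ∈ S, x ≠ y → (1 - 2 / (q : ℝ)) ≤ dist x y) → ∀ x ∈ S, ({y : EuclideanSpace ℝ (Fin 3) | y ∈ S ∧ y ≠ x ∧ dist x y ≤ 1 + τ}).encard ≤ 12) → Summit.AtomisticToContinuum.Crystallization.Theses.OneCentreSteepnessLadder.LocalTwelveRigidity → (∀ η : ℝ, 0 < η → ∃ γ : ℝ, 0 < γ ∧ ∀ ε : ℝ, 0 < ε → ∃ Rₑ : ℝ, ∃ g : EuclideanSpace ℝ (Fin 3) → Set (EuclideanSpace ℝ (Fin 3)) → ℝ, (∀ (v : EuclideanSpace ℝ (Fin 3)) (U : Set (EuclideanSpace ℝ (Fin 3))), Rₑ < ‖v‖ → g v U = 0) ∧ ∀ R : ℝ, Rₑ ≤ R → ∀ S : Set (EuclideanSpace ℝ (Fin 3)), (∀ x ∈ S, ∀ y ∈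 S, x ≠ y → (1 - 2 / (q : ℝ)) ≤ dist x y) → (∀ x ∈ S, ∀ y ∈ S, g (y - x) (((fun z : EuclideanSpace ℝ (Fin 3) => z - x) '' S) ∩ Metric.closedBall (0 : EuclideanSpace ℝ (Fin 3)) Rₑ) = - g (x - y) (((fun z : EuclideanSpace ℝ (Fin 3) => z - y) '' S) ∩ Metric.closedBall (0 : EuclideanSpace ℝ (Fin 3)) Rₑ)) ∧ ∀ x ∈ S, ((∑' y : ↥S, (if dist x (y : EuclideanSpace ℝ (Fin 3)) ≤ R then (2 * (dist x (y : EuclideanSpace ℝ (Fin 3)))⁻¹ ^ q - (dist x (y : EuclideanSpace ℝ (Fin 3)))⁻¹ ^ (2 * q)) else 0)) + (∑' y : ↥S, g ((y : EuclideanSpace ℝ (Fin 3)) - x) (((fun z : EuclideanSpace ℝ (Fin 3) => z - x) '' S) ∩ Metric.closedBall (0 : EuclideanSpace ℝ (Fin 3)) Rₑ)) ≤ (∑' p : ↥(Literature.MathematicalPhysics.StatisticalMechanics.hcpStacking a h), (2 * (‖(p : EuclideanSpace ℝ (Fin 3))‖)⁻¹ ^ q - (‖(p : EuclideanSpace ℝ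 (Fin 3))‖)⁻¹ ^ (2 * q))) + ε) ∧ (¬ (∃ A : EuclideanSpace ℝ (Fin 3) →ₗᵢ[ℝ] EuclideanSpace ℝ (Fin 3), (∀ p ∈ Literature.MathematicalPhysics.StatisticalMechanics.hcpStacking a h, ‖p‖ ≤ 5 / 3 * a → ∃ y ∈ S, dist y (x + A p) ≤ η) ∧ (∀ y ∈ S, dist y x ≤ 5 / 3 * a → ∃ p ∈ Literature.MathematicalPhysics.StatisticalMechanics.hcpStacking a h, dist y (x + A p) ≤ η)) → (∑' y : ↥S, (if dist x (y : EuclideanSpace ℝ (Fin 3)) ≤ R then (2 * (dist x (y : EuclideanSpace ℝ (Fin 3)))⁻¹ ^ q - (dist x (y : EuclideanSpace ℝ (Fin 3)))⁻¹ ^ (2 * q)) else 0)) + (∑' y : ↥S, g ((y : EuclideanSpace ℝ (Fin 3)) - x) (((fun z : EuclideanSpace ℝ (Fin 3) => z - x) '' S) ∩ Metric.closedBall (0 : EuclideanSpace ℝ (Fin 3)) Rₑ)) ≤ (∑' p : ↥(Literature.MathematicalPhysics.StatisticalMechanics.hcpStacking a h), (2 * (‖(p : EuclideanSpace ℝ (Fin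 3))‖)⁻¹ ^ q - (‖(p : EuclideanSpace ℝ (Fin 3))‖)⁻¹ ^ (2 * q))) + ε - γ))) →
    Summit.AtomisticToContinuum.Crystallization.Theses.OneCentreSteepnessLadder.LadderDomination := by
  intro hL hK hSc hT hE
  obtain ⟨q₄, hK⟩ := hK
  obtain ⟨q₂, hSc⟩ := hSc
  obtain ⟨q₃, hT⟩ := hT
  obtain ⟨q₁, hE⟩ := hE
  have key : ∃ q₀ : ℕ, ∀ q : ℕ, q₀ ≤ q → ∃ a h : ℝ, 0 < a ∧ 0 < h ∧ 2 * a < 3 * h ∧ 6 * h < 5 * a ∧ (∀ η : ℝ, 0 < η → ∃ γ : ℝ, 0 < γ ∧ ∀ ε : ℝ, 0 < ε → ∀ R₀ : ℝ, ∃ R : ℝ, R₀ ≤ R ∧ ∃ g : EuclideanSpace ℝ (Fin 3) → Set (EuclideanSpace ℝ (Fin 3)) → ℝ, (∀ (v : EuclideanSpace ℝ (Fin 3)) (U : Set (EuclideanSpace ℝ (Fin 3))), R < ‖v‖ → g v U = 0) ∧ ∀ S : Set (EuclideanSpace ℝ (Fin 3)), (∀ x ∈ S, ∀ y ∈ S,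 x ≠ y → (1 - 2 / (q : ℝ)) ≤ dist x y) → (∀ x ∈ S, ∀ y ∈ S, g (y - x) (((fun z : EuclideanSpace ℝ (Fin 3) => z - x) '' S) ∩ Metric.closedBall (0 : EuclideanSpace ℝ (Fin 3)) R) = - g (x - y) (((fun z : EuclideanSpace ℝ (Fin 3) => z - y) '' S) ∩ Metric.closedBall (0 : EuclideanSpace ℝ (Fin 3)) R)) ∧ ∀ x ∈ S, ((∑' y : ↥S, (if dist x (y : EuclideanSpace ℝ (Fin 3)) ≤ R then (2 * (dist x (y : EuclideanSpace ℝ (Fin 3)))⁻¹ ^ q - (dist x (y : EuclideanSpace ℝ (Fin 3)))⁻¹ ^ (2 * q)) else 0)) + (∑' y : ↥S, g ((y : EuclideanSpace ℝ (Fin 3)) - x) (((fun z : EuclideanSpace ℝ (Fin 3) => z - x) '' S) ∩ Metric.closedBall (0 : EuclideanSpace ℝ (Fin 3)) R)) ≤ (∑' p : ↥(Literature.MathematicalPhysics.StatisticalMechanics.hcpStacking a h), (2 * (‖(p : EuclideanSpace ℝ (Fin 3))‖)⁻¹ ^ q - (‖(p : EuclideanSpace ℝ (Fin 3))‖)⁻¹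 ^ (2 * q))) + ε) ∧ (¬ (∃ A : EuclideanSpace ℝ (Fin 3) →ₗᵢ[ℝ] EuclideanSpace ℝ (Fin 3), (∀ p ∈ Literature.MathematicalPhysics.StatisticalMechanics.hcpStacking a h, ‖p‖ ≤ 5 / 3 * a → ∃ y ∈ S, dist y (x + A p) ≤ η) ∧ (∀ y ∈ S, dist y x ≤ 5 / 3 * a → ∃ p ∈ Literature.MathematicalPhysics.StatisticalMechanics.hcpStacking a h, dist y (x + A p) ≤ η)) → (∑' y : ↥S, (if dist x (y : EuclideanSpace ℝ (Fin 3)) ≤ R then (2 * (dist x (y : EuclideanSpace ℝ (Fin 3)))⁻¹ ^ q - (dist x (y : EuclideanSpace ℝ (Fin 3)))⁻¹ ^ (2 * q)) else 0)) + (∑' y : ↥S, g ((y : EuclideanSpace ℝ (Fin 3)) - x) (((fun z : EuclideanSpace ℝ (Fin 3) => z - x) '' S) ∩ Metric.closedBall (0 : EuclideanSpace ℝ (Fin 3)) R)) ≤ (∑' p : ↥(Literature.MathematicalPhysics.StatisticalMechanics.hcpStacking a h), (2 * (‖(p : EuclideanSpace ℝ (Fin 3))‖)⁻¹ ^ q -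 (‖(p : EuclideanSpace ℝ (Fin 3))‖)⁻¹ ^ (2 * q))) + ε - γ)) := by
    refine ⟨q₁ + q₂ + q₃ + q₄, fun q hq => ?_⟩
    obtain ⟨a, h, ha, hh, hw₁, hw₂, hb₁, hb₂, hmax⟩ := hSc q (by omega)
    obtain ⟨Δ, hΔ, htab⟩ := hT q (by omega) a h hb₁ hb₂ hh hw₁ hw₂
    obtain ⟨τ, hτ, hkiss⟩ := hK q (by omega)
    exact ⟨a, h, ha, hh, hw₁, hw₂, cruxMatrix_of_uniform q a h
      (hE q (by omega) a h ha hh hw₁ hw₂ hmax Δ hΔ htab τ hτ hkiss hL)⟩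
  exact key

/-- **The crux BY NAME from the five stubs** (type literally the route decl; the only `sorry`s in
its cone are the five `stub_*`). -/
theorem LadderDomination_of_stubs : Summit.AtomisticToContinuum.Crystallization.Theses.OneCentreSteepnessLadder.LadderDomination :=
  LadderDomination_of stub_localTwelveRigidity stub_kissingSlack stub_hcpScaleSelection
    stub_barlowSiteTable stub_dominationEngine

/-! ## By-name readings (certify that the inlined signatures are the named statements) -/

/-- Stub 1 is item 12883's decl. -/
example : Summit.AtomisticToContinuum.Crystallization.Theses.OneCentreSteepnessLadder.LocalTwelveRigidity := stub_localTwelveRigidity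

/-- Stub 2 is `∃ q₀ ∀ q ≥ q₀ ∃ τ > 0, KissingSlack q τ`. -/
example : ∃ q₄ : ℕ, ∀ q : ℕ, q₄ ≤ q → ∃ τ : ℝ, 0 < τ ∧ KissingSlack q τ := stub_kissingSlack

/-- Stub 3 is `∃ q₀ ∀ q ≥ q₀ ∃ a h, window ∧ box ∧ CoerciveHcpScale q a h`. -/
example : ∃ q₂ : ℕ, ∀ q : ℕ, q₂ ≤ q → ∃ a h : ℝ, 0 < a ∧ 0 < h ∧ 2 * a < 3 * h ∧ 6 * h < 5 * a ∧
    9 / 10 ≤ a ∧ a ≤ 11 / 10 ∧ CoerciveHcpScale q a h := stub_hcpScaleSelection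

/-- Stub 4 is `∃ q₀ ∀ q ≥ q₀ ∀ (a, h) ∈ box × window, ∃ Δ > 0, BarlowSiteTable q a h Δ`. -/
example : ∃ q₃ : ℕ, ∀ q : ℕ, q₃ ≤ q → ∀ a h : ℝ, 9 / 10 ≤ a → a ≤ 11 / 10 → 0 < h → 2 * a < 3 * h →
    6 * h < 5 * a → ∃ Δ : ℝ, 0 < Δ ∧ BarlowSiteTable q a h Δ := stub_barlowSiteTable

/-- Stub 5 is `inputs → UniformDomination q a h`. -/
example : ∃ q₁ : ℕ, ∀ q : ℕ, q₁ ≤ q → ∀ a h : ℝ, 0 < a → 0 < h → 2 * a < 3 * h → 6 * h < 5 * a →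
    CoerciveHcpScale q a h → ∀ Δ : ℝ, 0 < Δ → BarlowSiteTable q a h Δ → ∀ τ : ℝ, 0 < τ →
    KissingSlack q τ → Summit.AtomisticToContinuum.Crystallization.Theses.OneCentreSteepnessLadder.LocalTwelveRigidity → UniformDomination q a h :=
  stub_dominationEngine

/-- Uniform-radius domination implies the crux matrix (named form of `cruxMatrix_of_uniform`). -/
example (q : ℕ) (a h : ℝ) (hU : UniformDomination q a h) :
    (∀ η : ℝ, 0 < η → ∃ γ : ℝ, 0 < γ ∧ ∀ ε : ℝ, 0 < ε → ∀ R₀ : ℝ, ∃ R : ℝ, R₀ ≤ R ∧ ∃ g : EuclideanSpace ℝ (Fin 3) → Set (EuclideanSpace ℝ (Fin 3)) → ℝ, (∀ (v : EuclideanSpace ℝ (Fin 3)) (U : Set (EuclideanSpace ℝ (Fin 3))), R < ‖v‖ → g v U = 0) ∧ ∀ S : Set (EuclideanSpace ℝ (Fin 3)), (∀ x ∈ S, ∀ y ∈ S, x ≠ y → (1 - 2 / (q : ℝ)) ≤ dist x y) → (∀ x ∈ S, ∀ y ∈ S, g (y - x) (((fun z : EuclideanSpace ℝ (Fin 3) =>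 z - x) '' S) ∩ Metric.closedBall (0 : EuclideanSpace ℝ (Fin 3)) R) = - g (x - y) (((fun z : EuclideanSpace ℝ (Fin 3) => z - y) '' S) ∩ Metric.closedBall (0 : EuclideanSpace ℝ (Fin 3)) R)) ∧ ∀ x ∈ S, ((∑' y : ↥S, (if dist x (y : EuclideanSpace ℝ (Fin 3)) ≤ R then (2 * (dist x (y : EuclideanSpace ℝ (Fin 3)))⁻¹ ^ q - (dist x (y : EuclideanSpace ℝ (Fin 3)))⁻¹ ^ (2 * q)) else 0)) + (∑' y : ↥S, g ((y : EuclideanSpace ℝ (Fin 3)) - x) (((fun z : EuclideanSpace ℝ (Fin 3) => z - x) '' S) ∩ Metric.closedBall (0 : EuclideanSpace ℝ (Fin 3)) R)) ≤ (∑' p : ↥(Literature.MathematicalPhysics.StatisticalMechanics.hcpStacking a h), (2 * (‖(p : EuclideanSpace ℝ (Fin 3))‖)⁻¹ ^ q - (‖(p : EuclideanSpace ℝ (Fin 3))‖)⁻¹ ^ (2 * q))) + ε) ∧ (¬ (∃ A : EuclideanSpace ℝ (Fin 3) →ₗᵢ[ℝ] EuclideanSpace ℝ (Fin 3), (∀ p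 ∈ Literature.MathematicalPhysics.StatisticalMechanics.hcpStacking a h, ‖p‖ ≤ 5 / 3 * a → ∃ y ∈ S, dist y (x + A p) ≤ η) ∧ (∀ y ∈ S, dist y x ≤ 5 / 3 * a → ∃ p ∈ Literature.MathematicalPhysics.StatisticalMechanics.hcpStacking a h, dist y (x + A p) ≤ η)) → (∑' y : ↥S, (if dist x (y : EuclideanSpace ℝ (Fin 3)) ≤ R then (2 * (dist x (y : EuclideanSpace ℝ (Fin 3)))⁻¹ ^ q - (dist x (y : EuclideanSpace ℝ (Fin 3)))⁻¹ ^ (2 * q)) else 0)) + (∑' y : ↥S, g ((y : EuclideanSpace ℝ (Fin 3)) - x) (((fun z : EuclideanSpace ℝ (Fin 3) => z - x) '' S) ∩ Metric.closedBall (0 : EuclideanSpace ℝ (Fin 3)) R)) ≤ (∑' p : ↥(Literature.MathematicalPhysics.StatisticalMechanics.hcpStacking a h), (2 * (‖(p : EuclideanSpace ℝ (Fin 3))‖)⁻¹ ^ q - (‖(p : EuclideanSpace ℝ (Fin 3))‖)⁻¹ ^ (2 * q))) + ε - γ)) :=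
  cruxMatrix_of_uniform q a h hU

end Summit.AtomisticToContinuum.Crystallization.Cruxes.LadderDomination.Birth
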